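import Summits.ABC.IUTFork.Cor312LicenceWildInhabitedGenuineK
import Summits.ABC.IUTFork.Cor312ProvKRamified
import Literature.IUT.LogVolume.GenuineLogThetaPoint
import Literature.IUT.LogVolume.Corollary22FreyPoint
import Literature.IUT.LogVolume.Corollary22RatPointDictionary
import Literature.IUT.LogVolume.UnitLogVolume
import Literature.IUT.LogVolume.UnitLogMaxNorm
import Literature.IUT.LogVolume.UnitLogValuationSpectrum
import Literature.IUT.LogVolume.UnitLogWildDepth
import Literature.IUT.LogVolume.DifferentEstimatesCorollaries
import HarnessLib

/-!
# R-W WINDOW-TABLE, W1 ROW DECISIONS (inhabited side) — LOCAL PACKAGES: one-sided shell radii from the ramification index,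
# and the known abc triple `283 + 5¹¹·13² = 2⁸·3⁸·17³` (pole orders of `j`, bad primes of a genuine Θ-volume datum over it)

PROOF-ONLY file (D-0012; 0 definitions, 0 `Prop` facts) of the abc-iut cell — D-0079 RESCUE sub-cell R-W «WINDOW Θ-SIDE INEQUALITY», W1 ROW
DECISIONS composer seat abc-iut-W-row-1 (gen 0); row 1 of HOME/plan/rescue/R-W/OPEN-10.md (sha16 1b0025ee7a8ba6d7, abc-iut-rw-num-lead):
`pilotDataOfK:frey-283-8251953125-8251953408:13`. TAKES NO SIDE on [IUTchIII] Cor. 3.12 (S. Mochizuki, *Inter-universal Teichmüller theory III*,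
Cor. 3.12 p. 173–174; Step (xi-f) p. 184) or on any author; «inhabited as typed» ≠ «asserted in print».

WHAT IS PROVED (namespace `Summit.ABC.IUTFork.Conditional`).
* §1 LOCAL PACKAGES (classical, any proper ultrametric `ℚ_p`-field `K`): `WRow.exists_not_mem_logUnits_norm_le_one` (`𝒪_K ⊄ log_p(𝒪_K^×)` —
  volume `p^{−(f+m)} < 1`, [IUTchIV] Prop. 1.4 (ii); the TRIVIAL inner-radius reading `ρin = 1`, valid at EVERY index — in particular at the
  tie indices `e = A(p−1)`, `p ∣ A`, `ζ_p ∈ K` where the exact inner radius is open in the tree); `WRow.inner_witness_of_not_dvd` (`(p−1) ∤ e`: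
  `ϖ^{⌊e/(p−1)⌋} ∉ log_p(𝒪^×)`, abc-iut-c312-3 `not_closedBall_div_subset_logUnits`); `WRow.outer_witness_envelope` (`log_p(1+ϖ)` has norm
  `‖ϖ‖^{p^{a₀} − e·a₀}` at a strict turning point `a₀`, abc-iut-c312-3 `exists_mem_logUnits_norm_eq_envelope`).
* §2 THE TRIPLE: `isABCTriple_frey283`, the exact pole orders `ord_p j(283/c) = −2·v_p(abc)` at `p ∈ {3,5,13,17,283}`
  (`Corollary22RatPointDictionary`), and «a bad fibre point lies over `{3, 5, 17, 283}`» at `l = 13`.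
* `WRow.bad_prime_frey283` — at ANY `l`, a bad fibre point of a genuine Θ-volume datum over `(ratPoint (283/c), l)` lies over
  `p ∈ {3, 5, 13, 17, 283} ∖ {l}`, with the pole order of `j` there.
Consumers: the row files `WRowFrey283Thirteen/Seventeen/Nineteen.lean` (rows 1–3 of HOME/plan/rescue/R-W/OPEN-10.md). HONEST SCOPE: classical
local algebra and valuation bookkeeping on OUR typed objects; nothing about the printed inequality; typed ≠ proved; no abc claim.
[cite: Mochizuki2012, IUTchI Def. 3.1 (b),(c) pp. 61–62, Ex. 3.2 (iv) p. 71; IUTchIII Cor. 3.12 Step (xi-f) p. 184; IUTchIV Prop. 1.1 p. 9,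
Prop. 1.2 (i)(ii) p. 10, Prop. 1.4 (ii) p. 13, Cor. 2.2 (ii) proof (P5) p. 46] [cite: DupuyHilado2025, §3.3, §3.4, §4.9, §4.12]
[cite: NeukirchANT1999, Ch. II (5.5)] [cite: SilvermanAEC2009, Prop. III.1.7(b)] [claim: Mochizuki2012, status: disputed] for every IUT sentence.
-/

noncomputable section

open Set Function Metric NumberField IsDedekindDomain MeasureTheory

namespace Summit.ABC.IUTFork.Conditional

open Thm311 Thm311.Real Cor312 Cor312Vol Cor312Prov Literature.IUT.LogThetaLattice Literature.IUT.LogVolume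
  Literature.IUT.HodgeTheaters Literature.IUT.LogVolume.Cor22
open Literature.NumberTheory.NumberFields Literature.NumberTheory.GaloisRepresentations.Ultrametric
open Literature.NumberTheory.DiophantineGeometry Literature.NumberTheory.DiophantineGeometry.GenEll

/-! ## §1. Local packages: one-sided shell radii from the ramification index alone -/

section LocalPackages

variable (p : ℕ) [Fact p.Prime] (K : Type) [NontriviallyNormedField K] [instK : NormedAlgebra ℚ_[p] K] [IsUltrametricDist K]
  [ProperSpace K]

include instK in
/-- **`𝒪_K ⊄ log_p(𝒪_K^×)`: a non-member of norm `≤ 1` exists in EVERY local field** — the trivial inner-radius reading `ρin = 1`. Volume: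
`μ(log_p(𝒪_K^×)) = p^{−(f+m)} < 1 = μ(𝒪_K)` ([IUTchIV] Prop. 1.4 (ii), the tree's `localVolume_real_logUnits_eq_inv_pow`).
[cite: Mochizuki2012, IUTchIV Prop. 1.4 (ii) p. 13] -/
theorem WRow.exists_not_mem_logUnits_norm_le_one : ∃ z : K, z ∉ logUnits K ∧ ‖z‖ ≤ 1 := by
  letI : MeasurableSpace K := borel K
  haveI : BorelSpace K := ⟨rfl⟩
  by_contra h
  push Not at h
  have hsub : closedBall (0 : K) 1 ⊆ logUnits K := by
    intro z hz
    rw [mem_closedBall, dist_zero_right] at hz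
    by_contra hz'
    exact absurd hz (not_le.mpr (h z hz'))
  have hmono := measure_mono (μ := localVolume K) hsub
  rw [localVolume_closedBall_one] at hmono
  have hpos := localVolume_real_logUnits_pos p K
  have hfin : localVolume K (logUnits K) ≠ ⊤ := (ENNReal.toReal_pos_iff.mp hpos).2.ne
  have h1 : (1 : ℝ) ≤ (localVolume K (logUnits K)).toReal := by
    have := ENNReal.toReal_mono hfin hmono
    simpa using this
  rw [localVolume_real_logUnits_eq_inv_pow p K] at h1
  have hp1 : (1 : ℝ) < p := by exact_mod_cast (Fact.out : p.Prime).one_lt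
  have hlt : ((p : ℝ) ^ (residueDegree p K + torsionPExp p K))⁻¹ < 1 :=
    inv_lt_one_of_one_lt₀ (one_lt_pow₀ hp1 (by have := residueDegree_pos p K; omega))
  linarith

include instK in
/-- The trivial inner-radius reading in socket form: a non-member of norm `≤ p^{−(1−1)/e} = 1`. [cite: Mochizuki2012, IUTchIV Prop. 1.4 (ii) p. 13] -/
theorem WRow.inner_witness_trivial (e : ℕ) :
    ∃ z : K, z ∉ logUnits K ∧ ‖z‖ ≤ (p : ℝ) ^ (-((((1 : ℤ) : ℝ) - 1) / (e : ℝ))) := by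
  obtain ⟨z, hz, hz1⟩ := WRow.exists_not_mem_logUnits_norm_le_one p K
  refine ⟨z, hz, ?_⟩
  rw [show (-((((1 : ℤ) : ℝ) - 1) / (e : ℝ))) = 0 by push_cast; ring, Real.rpow_zero]
  exact hz1

include instK in
/-- **Inner witness off the tie indices**: `(p−1) ∤ e` ⇒ some `z ∉ log_p(𝒪_K^×)` has `‖z‖ ≤ p^{−(ρ−1)/e}` with `ρ = ⌊e/(p−1)⌋ + 1`
(abc-iut-c312-3's `not_closedBall_div_subset_logUnits`: `ϖ^{⌊e/(p−1)⌋}` is not a logarithm). [cite: NeukirchANT1999, Ch. II (5.5)] -/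
theorem WRow.inner_witness_of_not_dvd {e : ℕ} (he : absRamificationIdx p K = e) (hnd : ¬ (p - 1 ∣ e)) (ρ : ℤ)
    (hρ : ρ = ((e / (p - 1) : ℕ) : ℤ) + 1) :
    ∃ z : K, z ∉ logUnits K ∧ ‖z‖ ≤ (p : ℝ) ^ (-(((ρ : ℝ) - 1) / (e : ℝ))) := by
  obtain ⟨ϖ, hϖ⟩ := exists_isUniformizer (F := K)
  have hnd' : ¬ (p - 1 ∣ absRamificationIdx p K) := by rwa [he]
  obtain ⟨z, hz, hzΛ⟩ := not_subset.mp (LogEnvelope.not_closedBall_div_subset_logUnits p hϖ hnd')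
  refine ⟨z, hzΛ, ?_⟩
  rw [mem_closedBall, dist_zero_right, ← zpow_natCast, RamificationCriterion.norm_unif_zpow_eq_rpow p hϖ, he] at hz
  convert hz using 2
  rw [hρ]; push_cast; ring

include instK in
/-- **Outer witness at a strict turning point**: if `p^a(p−1) < e` for `a < a₀` and `e < p^{a₀}(p−1)` then `log_p(1+ϖ) ∈ log_p(𝒪_K^×)` has
norm `‖ϖ‖^{p^{a₀} − e·a₀} = p^{−ρ/e}`, `ρ = p^{a₀} − e·a₀` (abc-iut-c312-3's `exists_mem_logUnits_norm_eq_envelope`; `a₀ = 0` is the tame case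
`e < p−1`, `ρ = 1`). [cite: NeukirchANT1999, Ch. II (5.5)] -/
theorem WRow.outer_witness_envelope {e : ℕ} (he : absRamificationIdx p K = e) (a₀ : ℕ)
    (hlo : ∀ a < a₀, (p : ℤ) ^ a * ((p : ℤ) - 1) < e) (hhi : (e : ℤ) < (p : ℤ) ^ a₀ * ((p : ℤ) - 1)) (ρ : ℤ)
    (hρ : ρ = (p : ℤ) ^ a₀ - (e : ℤ) * (a₀ : ℤ)) :
    ∃ z ∈ logUnits K, (p : ℝ) ^ (-((ρ : ℝ) / (e : ℝ))) ≤ ‖z‖ := by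
  obtain ⟨ϖ, hϖ⟩ := exists_isUniformizer (F := K)
  obtain ⟨z, hz, hzn⟩ := LogEnvelope.exists_mem_logUnits_norm_eq_envelope p hϖ (a₀ := a₀) (by rw [he]; exact hlo) (by rw [he]; exact hhi)
  refine ⟨z, hz, le_of_eq ?_⟩
  rw [hzn, RamificationCriterion.norm_unif_zpow_eq_rpow p hϖ, he, hρ]
  push_cast; ring_nf

include instK in
/-- **Tame different as a lower bound**: `p ∤ e` ⇒ `(e−1)/e ≤ d(K)` (indeed `=`, `differentOrd_eq_of_not_dvd`).
[cite: SerreLocalFields1979, Ch. III §6 Prop. 13] -/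
theorem WRow.different_lower_of_not_dvd {e : ℕ} (he : absRamificationIdx p K = e) (hpe : ¬ p ∣ e) (D : ℕ) (hD : D + 1 = e) :
    (D : ℝ) / (e : ℝ) ≤ differentOrd p K := by
  rw [differentOrd_eq_of_not_dvd p K (by rwa [he]), he]
  have : (D : ℝ) = (e : ℝ) - 1 := by
    have : (e : ℝ) = (D : ℝ) + 1 := by exact_mod_cast hD.symm
    linarith
  rw [this]

end LocalPackages

/-! ## §2. The triple `283 + 5¹¹·13² = 2⁸·3⁸·17³`: pole orders of `j(283/c)` and the bad primes at `l = 13` -/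

section Triple

/-- `283 + 5¹¹·13² = 2⁸·3⁸·17³` (`= 8251953408`) is an abc triple. [folklore] -/
theorem isABCTriple_frey283 : IsABCTriple 283 8251953125 8251953408 := by
  refine ⟨by norm_num, by norm_num, by norm_num, ?_⟩
  rw [Nat.coprime_iff_gcd_eq_one]
  decide

/-- The denominator of `j(283/c)`: `(abc)² = 2¹⁶·3¹⁶·5²²·13⁴·17⁶·283²`. [folklore] -/
theorem WRow.den_frey283 :
    (283 * 8251953125 * 8251953408) ^ 2 =
      ∏ p ∈ ({2, 3, 5, 13, 17, 283} : Finset ℕ),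
        p ^ (if p = 2 then 16 else if p = 3 then 16 else if p = 5 then 22 else if p = 13 then 4 else if p = 17 then 6 else 2) := by
  decide

/-- **`ord_p j(283/c) = −2·v_p(abc)`** at the places of `ℚ` over `p ∈ {3, 5, 13, 17, 283}` (Frey formula + the rational-point dictionary).
[cite: SilvermanAEC2009, Prop. III.1.7(b)] [cite: MochizukiGenEll2010, Def. 3.3 p. 12] -/
theorem WRow.ord_jInv_frey283 (v : HeightOneSpectrum (𝓞 ℚ)) {p₀ : ℕ} (hv : Rat.HeightOneSpectrum.natGenerator v = p₀)
    (hp₀ : p₀ = 3 ∨ p₀ = 5 ∨ p₀ = 13 ∨ p₀ = 17 ∨ p₀ = 283) :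
    ord ℚ v (jInv ((283 : ℚ) / 8251953408)) =
      -((if p₀ = 2 then 16 else if p₀ = 3 then 16 else if p₀ = 5 then 22 else if p₀ = 13 then 4 else if p₀ = 17 then 6 else 2 : ℕ) : ℤ) := by
  have hj : jInv ((283 : ℚ) / 8251953408) =
      ((256 * (8251953408 * 8251953125 + 283 * 283) ^ 3 : ℕ) : ℚ) / (((283 * 8251953125 * 8251953408) ^ 2 : ℕ) : ℚ) := by
    have h := jInv_ratPoint_triple isABCTriple_frey283
    push_cast at h ⊢
    exact h
  have hI : ∀ p ∈ ({2, 3, 5, 13, 17, 283} : Finset ℕ), p.Prime := by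
    intro p hp
    simp only [Finset.mem_insert, Finset.mem_singleton] at hp
    rcases hp with rfl | rfl | rfl | rfl | rfl | rfl <;> norm_num
  have hmem : p₀ ∈ ({2, 3, 5, 13, 17, 283} : Finset ℕ) := by
    simp only [Finset.mem_insert, Finset.mem_singleton]
    rcases hp₀ with h | h | h | h | h <;> simp [h]
  have hcop : ¬ p₀ ∣ 256 * (8251953408 * 8251953125 + 283 * 283) ^ 3 := by
    rcases hp₀ with rfl | rfl | rfl | rfl | rfl <;> norm_num
  subst hv
  exact ord_jInv_ratPoint_of_mem hI WRow.den_frey283 hj (by norm_num) v hmem hcop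

/-- The POLES of `j(283/c)` lie over `{2, 3, 5, 13, 17, 283}`. [cite: MochizukiGenEll2010, Def. 3.3 p. 12] -/
theorem WRow.natGenerator_mem_of_ord_neg_frey283 (v : HeightOneSpectrum (𝓞 ℚ)) (hneg : ord ℚ v (jInv ((283 : ℚ) / 8251953408)) < 0) :
    Rat.HeightOneSpectrum.natGenerator v ∈ ({2, 3, 5, 13, 17, 283} : Finset ℕ) := by
  by_contra hv
  have hj : jInv ((283 : ℚ) / 8251953408) =
      ((256 * (8251953408 * 8251953125 + 283 * 283) ^ 3 : ℕ) : ℚ) / (((283 * 8251953125 * 8251953408) ^ 2 : ℕ) : ℚ) := by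
    have h := jInv_ratPoint_triple isABCTriple_frey283
    push_cast at h ⊢
    exact h
  have hI : ∀ p ∈ ({2, 3, 5, 13, 17, 283} : Finset ℕ), p.Prime := by
    intro p hp
    simp only [Finset.mem_insert, Finset.mem_singleton] at hp
    rcases hp with rfl | rfl | rfl | rfl | rfl | rfl <;> norm_num
  have := ord_jInv_ratPoint_nonneg_of_not_mem hI WRow.den_frey283 hj (by norm_num) v hv
  omega

end Triple

/-! ## §3. Which primes carry the bad fibre points -/

/-- **Which primes carry bad fibre points at `(ratPoint (283/c), l)`, and the pole order there**: a bad `x | p` forces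
`p ∈ {3, 5, 13, 17, 283} ∖ {l}` (`‖t_q(x)‖ < 1` for the chosen realising q-idele, i.e. a pole of `j`; `p ≠ 2, l`) and `ord_p j(283/c) = −2·v_p(abc)`.
[cite: Mochizuki2012, IUTchIV Cor. 2.2 (ii) proof (P5) p. 46] -/
theorem WRow.bad_prime_frey283 {l : ℕ} (T : Cor22.ThetaVolumeDatumAt (ratPoint ((283 : ℚ) / 8251953408)) l) (pp : Nat.Primes) :
    letI := T.instFieldF; letI := T.instNumberFieldF; letI := T.instAlgebraF; letI := T.instFieldK
    letI := T.instNumberFieldK; letI := T.instAlgebraK; letI := T.instFieldFbar; letI := T.instAlgebraFbar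
    letI := T.instAlgebraKFbar; letI := T.instIsElliptic
    haveI : Fact (pp : ℕ).Prime := ⟨pp.2⟩
    ∀ x : (thetaIndex (pilotDataOfK T.D T.K)).Fibre (.inr pp), placeOf (pilotDataOfK T.D T.K) pp.1 x ∈ (pilotDataOfK T.D T.K).S →
      (pp : ℕ) ≠ l ∧ (((pp : ℕ) = 3 ∧ ord ℚ (finBelow ℚ T.K (placeOf (pilotDataOfK T.D T.K) pp.1 x)) (jInv ((283 : ℚ) / 8251953408)) = -16) ∨
      ((pp : ℕ) = 5 ∧ ord ℚ (finBelow ℚ T.K (placeOf (pilotDataOfK T.D T.K) pp.1 x)) (jInv ((283 : ℚ) / 8251953408)) = -22) ∨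
      ((pp : ℕ) = 13 ∧ ord ℚ (finBelow ℚ T.K (placeOf (pilotDataOfK T.D T.K) pp.1 x)) (jInv ((283 : ℚ) / 8251953408)) = -4) ∨
      ((pp : ℕ) = 17 ∧ ord ℚ (finBelow ℚ T.K (placeOf (pilotDataOfK T.D T.K) pp.1 x)) (jInv ((283 : ℚ) / 8251953408)) = -6) ∨
      ((pp : ℕ) = 283 ∧ ord ℚ (finBelow ℚ T.K (placeOf (pilotDataOfK T.D T.K) pp.1 x)) (jInv ((283 : ℚ) / 8251953408)) = -2)) := by
  letI := T.instFieldF; letI := T.instNumberFieldF; letI := T.instAlgebraF; letI := T.instFieldK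
  letI := T.instNumberFieldK; letI := T.instAlgebraK; letI := T.instFieldFbar; letI := T.instAlgebraFbar
  letI := T.instAlgebraKFbar; letI := T.instIsElliptic
  haveI : Fact (pp : ℕ).Prime := ⟨pp.2⟩
  intro x hx
  have hjF : T.E.j = ((jInv ((283 : ℚ) / 8251953408) : ℚ) : T.F) := by rw [T.j_eq]; exact eq_ratCast _ _
  have hp1 : (1 : ℝ) < ((pp : ℕ) : ℝ) := by exact_mod_cast pp.2.one_lt
  have hgen := natGenerator_finBelow_placeOf T.D pp x
  -- a pole of `j` under the bad place
  have hneg : ord ℚ (finBelow ℚ T.K (placeOf (pilotDataOfK T.D T.K) pp.1 x)) (jInv ((283 : ℚ) / 8251953408)) < 0 := by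
    have hlt := norm_chosenQIdele_lt_one T.D pp x hx
    rw [norm_chosenQIdele_eq_rpow_ord_rat' T.D pp x hx _ hjF] at hlt
    by_contra hge
    push Not at hge
    have hl : (0 : ℝ) < 2 * (l : ℕ) := by
      have : 0 < l := lt_of_lt_of_le (by norm_num) T.D.five_le_l
      positivity
    have hexp : (0 : ℝ) ≤ (ord ℚ (finBelow ℚ T.K (placeOf (pilotDataOfK T.D T.K) pp.1 x)) (jInv ((283 : ℚ) / 8251953408)) : ℝ) /
        (2 * (l : ℕ)) := div_nonneg (by exact_mod_cast hge) hl.le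
    have h1 := (Real.rpow_le_rpow_left_iff hp1).mpr hexp
    rw [Real.rpow_zero] at h1
    linarith
  have hmem := WRow.natGenerator_mem_of_ord_neg_frey283 _ hneg
  rw [hgen] at hmem
  obtain ⟨h2, hl'⟩ := ne_two_and_ne_l_of_placeOf_mem_S_pilotDataOfK T.D pp x hx
  refine ⟨hl', ?_⟩
  simp only [Finset.mem_insert, Finset.mem_singleton] at hmem
  have hord : ∀ {p₀ : ℕ}, (pp : ℕ) = p₀ → (p₀ = 3 ∨ p₀ = 5 ∨ p₀ = 13 ∨ p₀ = 17 ∨ p₀ = 283) →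
      ord ℚ (finBelow ℚ T.K (placeOf (pilotDataOfK T.D T.K) pp.1 x)) (jInv ((283 : ℚ) / 8251953408)) =
        -((if p₀ = 2 then 16 else if p₀ = 3 then 16 else if p₀ = 5 then 22 else if p₀ = 13 then 4 else if p₀ = 17 then 6 else 2 : ℕ) : ℤ) :=
    fun hp hp₀ => WRow.ord_jInv_frey283 _ (hgen.trans hp) hp₀
  rcases hmem with h | h | h | h | h | h
  · exact absurd h h2
  · exact Or.inl ⟨h, by simpa using hord h (by norm_num)⟩
  · exact Or.inr (Or.inl ⟨h, by simpa using hord h (by norm_num)⟩)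
  · exact Or.inr (Or.inr (Or.inl ⟨h, by simpa using hord h (by norm_num)⟩))
  · exact Or.inr (Or.inr (Or.inr (Or.inl ⟨h, by simpa using hord h (by norm_num)⟩)))
  · exact Or.inr (Or.inr (Or.inr (Or.inr ⟨h, by simpa using hord h (by norm_num)⟩)))

end Summit.ABC.IUTFork.Conditional

end
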